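import Literature.Analysis.Complex.SchwarzReflection
import Mathlib.Analysis.Complex.AbsMax
import HarnessLib

/-!
# Harnack's inequality for half-plane-valued maps; a half-disc comparison lemma

Elementary potential theory in holomorphic clothing (positive harmonic functions are handled as
imaginary parts of holomorphic maps into the upper half-plane `ℍ`), for the harmonic-measure
estimates behind [LSW] Lemma 6.3 (`Literature/Probability/RandomPlanarGeometry/SLERestriction*`):

* `Complex.im_apply_ge_harnack`, `Complex.im_apply_le_harnack` — **Harnack's inequality**: for
  `Q` holomorphic on `B(c, R)` with `im Q > 0`,
  `im Q(c) (R - |z-c|)/(R + |z-c|) ≤ im Q(z) ≤ im Q(c) (R + |z-c|)/(R - |z-c|)` (Cayley map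
  `w ↦ (w - a)/(w - ā)`, `a = Q(c)`, and Schwarz's lemma, as for the Schwarz–Pick estimate
  `Complex.norm_deriv_le_two_mul_im_div` of `SchwarzReflection`); Conway, *Functions of One
  Complex Variable I*, Ch. X §2 (Harnack's inequality);
* `Complex.im_apply_ge_harnack_chain` — iterated along a segment covered by discs: a Harnack
  chain of `n` steps loses at most a factor `3ⁿ`;
* `Complex.im_apply_mul_I_ge_of_halfDisc` — **half-disc comparison**: if `Q` is holomorphic on
  a neighbourhood of the closed upper half-disc `{|w| ≤ r, im w ≥ 0}`, `im Q ≥ 0` there and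
  `im Q ≥ m` on the middle arc `{|w| = r, im w ≥ r/√2}`, then `im Q(iy) ≥ (m/(2r)) y` for
  `0 < y < r` — the maximum principle (`Complex.norm_le_of_forall_mem_frontier_norm_le` applied
  to `exp(i(Q - (m/2)P))`) against the explicit harmonic minorant
  `im P`, `P(w) = w/r - w³/r³`, whose boundary values are `im P = 0` on the diameter,
  `im P = 2y(2y² - r²)/r³ ≤ 0` on the side arcs and `≤ 2` on the middle arc, and
  `im P(iy) = y/r + y³/r³`.

Mathlib: `Complex.dist_le_div_mul_dist_of_mapsTo_ball` (Schwarz), `Complex.norm_le_of_forall_mem_frontier_norm_le`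
(maximum modulus on bounded sets), `frontier_inter_subset`, `Complex.frontier_setOf_lt_im`.
-/

noncomputable section

open Set Filter Metric Topology
open scoped ComplexConjugate

namespace Complex

/-! ### Harnack's inequality -/

section Harnack

variable {Q : ℂ → ℂ} {c : ℂ} {R : ℝ}

/-- The Cayley map `w ↦ (w - a)/(w - ā)` (`im a > 0`) inverts as
`im w = im a (1 - |h|²)/|1 - h|²` for `h = (w - a)/(w - ā)`, `im w > 0`. [folklore] -/
theorem im_eq_of_cayley {a w : ℂ} (ha : 0 < a.im) (hw : 0 < w.im) :
    w.im * ‖1 - (w - a) / (w - conj a)‖ ^ 2 = a.im * (1 - ‖(w - a) / (w - conj a)‖ ^ 2) := by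
  have hden : w - conj a ≠ 0 := fun h ↦ by
    have := congrArg Complex.im h
    simp only [sub_im, conj_im, zero_im] at this
    linarith
  have h1 : 1 - (w - a) / (w - conj a) = (a - conj a) / (w - conj a) := by
    field_simp
    ring
  rw [h1, norm_div, norm_div, div_pow, div_pow]
  have hn : ‖w - conj a‖ ^ 2 ≠ 0 := pow_ne_zero 2 (norm_ne_zero_iff.2 hden)
  field_simp
  rw [Complex.sq_norm, Complex.sq_norm, Complex.sq_norm, Complex.normSq_apply, Complex.normSq_apply,
    Complex.normSq_apply]
  simp only [sub_re, sub_im, conj_re, conj_im]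
  ring

/-- **Harnack's inequality, lower bound**: for `Q` holomorphic on `B(c, R)` with positive
imaginary part, `im Q(z) ≥ im Q(c) · (R - |z - c|)/(R + |z - c|)`.
[cite: Conway1978, Ch. X §2 (Harnack's inequality)] -/
theorem im_apply_ge_harnack (hR : 0 < R) (hd : DifferentiableOn ℂ Q (ball c R))
    (hpos : ∀ z ∈ ball c R, 0 < (Q z).im) {z : ℂ} (hz : z ∈ ball c R) :
    (Q c).im * ((R - ‖z - c‖) / (R + ‖z - c‖)) ≤ (Q z).im := by
  set a : ℂ := Q c with ha
  have ha0 : 0 < a.im := hpos c (mem_ball_self hR)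
  have hden : ∀ z ∈ ball c R, Q z - conj a ≠ 0 := fun z hz h ↦ by
    have := congrArg Complex.im h
    simp only [sub_im, conj_im, zero_im] at this
    linarith [hpos z hz]
  set F : ℂ → ℂ := fun z ↦ (Q z - a) / (Q z - conj a) with hF
  have hFd : DifferentiableOn ℂ F (ball c R) := (hd.sub_const a).div (hd.sub_const _) hden
  have hF0 : F c = 0 := by simp [hF, ha]
  have hmaps : MapsTo F (ball c R) (ball (F c) 1) := by
    intro w hw
    rw [hF0, mem_ball, dist_zero_right, hF]
    dsimp only
    rw [norm_div, div_lt_one (norm_pos_iff.2 (hden w hw))]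
    have h1 : ‖Q w - a‖ ^ 2 < ‖Q w - conj a‖ ^ 2 := by
      rw [Complex.sq_norm, Complex.sq_norm, Complex.normSq_apply, Complex.normSq_apply]
      simp only [sub_re, sub_im, conj_re, conj_im]
      nlinarith [hpos w hw, ha0]
    exact lt_of_pow_lt_pow_left₀ 2 (norm_nonneg _) h1
  -- Schwarz: `‖F z‖ ≤ ‖z - c‖ / R`
  have hS := Complex.dist_le_div_mul_dist_of_mapsTo_ball hFd (hmaps.mono_right ball_subset_closedBall) hz
  rw [hF0, dist_zero_right, dist_eq_norm] at hS
  set ρ : ℝ := ‖z - c‖ with hρ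
  have hρR : ρ < R := by rwa [mem_ball, dist_eq_norm] at hz
  have hρ0 : 0 ≤ ρ := norm_nonneg _
  have hFle : ‖F z‖ ≤ ρ / R := by rw [div_eq_inv_mul]; simpa using hS
  have hF1 : ‖F z‖ < 1 := lt_of_le_of_lt hFle ((div_lt_one hR).2 hρR)
  -- invert the Cayley map
  have hkey := im_eq_of_cayley ha0 (hpos z hz)
  have h1F : 0 < ‖1 - F z‖ := by
    refine norm_pos_iff.2 (sub_ne_zero.2 fun h ↦ ?_)
    have : ‖F z‖ = 1 := by rw [← h]; simp
    linarith
  -- `im Q z = im a (1 - |F|²)/|1-F|² ≥ im a (1-|F|)/(1+|F|) ≥ im a (R-ρ)/(R+ρ)`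
  have hq : (Q z).im = a.im * (1 - ‖F z‖ ^ 2) / ‖1 - F z‖ ^ 2 := by
    rw [eq_div_iff (pow_ne_zero 2 h1F.ne')]
    exact hkey
  have h1Fle : ‖1 - F z‖ ≤ 1 + ‖F z‖ := by
    calc ‖1 - F z‖ ≤ ‖(1 : ℂ)‖ + ‖F z‖ := norm_sub_le _ _
      _ = 1 + ‖F z‖ := by simp
  have hstep1 : a.im * ((1 - ‖F z‖) / (1 + ‖F z‖)) ≤ (Q z).im := by
    rw [hq, mul_div_assoc]
    refine mul_le_mul_of_nonneg_left ?_ ha0.le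
    rw [div_le_div_iff₀ (by positivity) (pow_pos h1F 2)]
    have : (1 - ‖F z‖) * ‖1 - F z‖ ^ 2 ≤ (1 - ‖F z‖) * (1 + ‖F z‖) ^ 2 :=
      mul_le_mul_of_nonneg_left (pow_le_pow_left₀ h1F.le h1Fle 2) (by linarith)
    nlinarith [norm_nonneg (F z)]
  have hstep2 : (R - ρ) / (R + ρ) ≤ (1 - ‖F z‖) / (1 + ‖F z‖) := by
    rw [div_le_div_iff₀ (by linarith) (by positivity)]
    have := mul_le_mul_of_nonneg_left hFle (by linarith : (0 : ℝ) ≤ 2 * R)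
    have h2 : 2 * R * (ρ / R) = 2 * ρ := by field_simp
    nlinarith [norm_nonneg (F z)]
  calc a.im * ((R - ρ) / (R + ρ)) ≤ a.im * ((1 - ‖F z‖) / (1 + ‖F z‖)) :=
        mul_le_mul_of_nonneg_left hstep2 ha0.le
    _ ≤ (Q z).im := hstep1

/-- **Harnack's inequality, upper bound**: for `Q` holomorphic on `B(c, R)` with positive
imaginary part, `im Q(z) ≤ im Q(c) · (R + |z - c|)/(R - |z - c|)`.
[cite: Conway1978, Ch. X §2 (Harnack's inequality)] -/
theorem im_apply_le_harnack (hR : 0 < R) (hd : DifferentiableOn ℂ Q (ball c R))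
    (hpos : ∀ z ∈ ball c R, 0 < (Q z).im) {z : ℂ} (hz : z ∈ ball c R) :
    (Q z).im ≤ (Q c).im * ((R + ‖z - c‖) / (R - ‖z - c‖)) := by
  set a : ℂ := Q c with ha
  have ha0 : 0 < a.im := hpos c (mem_ball_self hR)
  have hden : ∀ z ∈ ball c R, Q z - conj a ≠ 0 := fun z hz h ↦ by
    have := congrArg Complex.im h
    simp only [sub_im, conj_im, zero_im] at this
    linarith [hpos z hz]
  set F : ℂ → ℂ := fun z ↦ (Q z - a) / (Q z - conj a) with hF
  have hFd : DifferentiableOn ℂ F (ball c R) := (hd.sub_const a).div (hd.sub_const _) hden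
  have hF0 : F c = 0 := by simp [hF, ha]
  have hmaps : MapsTo F (ball c R) (ball (F c) 1) := by
    intro w hw
    rw [hF0, mem_ball, dist_zero_right, hF]
    dsimp only
    rw [norm_div, div_lt_one (norm_pos_iff.2 (hden w hw))]
    have h1 : ‖Q w - a‖ ^ 2 < ‖Q w - conj a‖ ^ 2 := by
      rw [Complex.sq_norm, Complex.sq_norm, Complex.normSq_apply, Complex.normSq_apply]
      simp only [sub_re, sub_im, conj_re, conj_im]
      nlinarith [hpos w hw, ha0]
    exact lt_of_pow_lt_pow_left₀ 2 (norm_nonneg _) h1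
  have hS := Complex.dist_le_div_mul_dist_of_mapsTo_ball hFd (hmaps.mono_right ball_subset_closedBall) hz
  rw [hF0, dist_zero_right, dist_eq_norm] at hS
  set ρ : ℝ := ‖z - c‖ with hρ
  have hρR : ρ < R := by rwa [mem_ball, dist_eq_norm] at hz
  have hρ0 : 0 ≤ ρ := norm_nonneg _
  have hFle : ‖F z‖ ≤ ρ / R := by rw [div_eq_inv_mul]; simpa using hS
  have hF1 : ‖F z‖ < 1 := lt_of_le_of_lt hFle ((div_lt_one hR).2 hρR)
  have hkey := im_eq_of_cayley ha0 (hpos z hz)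
  have h1F : 1 - ‖F z‖ ≤ ‖1 - F z‖ := by
    calc 1 - ‖F z‖ = ‖(1 : ℂ)‖ - ‖F z‖ := by simp
      _ ≤ ‖1 - F z‖ := norm_sub_norm_le _ _
  have h1F0 : 0 < 1 - ‖F z‖ := by linarith
  have h1Fpos : 0 < ‖1 - F z‖ := lt_of_lt_of_le h1F0 h1F
  have hq : (Q z).im = a.im * (1 - ‖F z‖ ^ 2) / ‖1 - F z‖ ^ 2 := by
    rw [eq_div_iff (pow_ne_zero 2 h1Fpos.ne')]
    exact hkey
  have hstep1 : (Q z).im ≤ a.im * ((1 + ‖F z‖) / (1 - ‖F z‖)) := by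
    rw [hq, mul_div_assoc]
    refine mul_le_mul_of_nonneg_left ?_ ha0.le
    rw [div_le_div_iff₀ (pow_pos h1Fpos 2) h1F0]
    have : (1 + ‖F z‖) * (1 - ‖F z‖) ^ 2 ≤ (1 + ‖F z‖) * ‖1 - F z‖ ^ 2 :=
      mul_le_mul_of_nonneg_left (pow_le_pow_left₀ h1F0.le h1F 2) (by positivity)
    nlinarith [norm_nonneg (F z)]
  have hstep2 : (1 + ‖F z‖) / (1 - ‖F z‖) ≤ (R + ρ) / (R - ρ) := by
    rw [div_le_div_iff₀ h1F0 (by linarith)]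
    have := mul_le_mul_of_nonneg_left hFle (by linarith : (0 : ℝ) ≤ 2 * R)
    have h2 : 2 * R * (ρ / R) = 2 * ρ := by field_simp
    nlinarith [norm_nonneg (F z)]
  calc (Q z).im ≤ a.im * ((1 + ‖F z‖) / (1 - ‖F z‖)) := hstep1
    _ ≤ a.im * ((R + ρ) / (R - ρ)) := mul_le_mul_of_nonneg_left hstep2 ha0.le

/-- One Harnack step at half the radius: `im Q(z) ≥ im Q(c)/3` for `|z - c| ≤ R/2`. [folklore] -/
theorem im_apply_ge_third (hR : 0 < R) (hd : DifferentiableOn ℂ Q (ball c R))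
    (hpos : ∀ z ∈ ball c R, 0 < (Q z).im) {z : ℂ} (hz : ‖z - c‖ ≤ R / 2) :
    (Q c).im / 3 ≤ (Q z).im := by
  have hzb : z ∈ ball c R := by rw [mem_ball, dist_eq_norm]; linarith
  have h := im_apply_ge_harnack hR hd hpos hzb
  have hq : (1 : ℝ) / 3 ≤ (R - ‖z - c‖) / (R + ‖z - c‖) := by
    rw [div_le_div_iff₀ (by norm_num) (by positivity)]
    nlinarith [norm_nonneg (z - c)]
  have ha0 : 0 ≤ (Q c).im := (hpos c (mem_ball_self hR)).le
  calc (Q c).im / 3 = (Q c).im * (1 / 3) := by ring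
    _ ≤ (Q c).im * ((R - ‖z - c‖) / (R + ‖z - c‖)) := mul_le_mul_of_nonneg_left hq ha0
    _ ≤ (Q z).im := h

/-- **Harnack chain along a segment.** Let `Q` be holomorphic with `im Q > 0` on a set `U`
containing the open `δ`-discs about the points of the segment `[p, p']`, and let
`|p' - p| ≤ n δ/2`. Then `im Q(p') ≥ im Q(p) / 3ⁿ`. [folklore] -/
theorem im_apply_ge_harnack_chain {U : Set ℂ} (hd : DifferentiableOn ℂ Q U)
    (hpos : ∀ z ∈ U, 0 < (Q z).im) {p p' : ℂ} {δ : ℝ} (hδ : 0 < δ)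
    (hseg : ∀ z ∈ segment ℝ p p', ball z δ ⊆ U) {n : ℕ} (hn : ‖p' - p‖ ≤ n * (δ / 2)) :
    (Q p).im / 3 ^ n ≤ (Q p').im := by
  -- the points `p_k = p + (k/n)(p' - p)`
  rcases Nat.eq_zero_or_pos n with rfl | hnpos
  · have : p' = p := by
      have h : ‖p' - p‖ ≤ 0 := by simpa using hn
      exact sub_eq_zero.1 (norm_le_zero_iff.1 h)
    subst this
    simp
  set v : ℂ := ((n : ℝ)⁻¹ : ℂ) * (p' - p) with hv
  have hvn : ‖v‖ ≤ δ / 2 := by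
    rw [hv, norm_mul, norm_inv, Complex.norm_real, Real.norm_eq_abs, abs_of_pos (by positivity),
      inv_mul_le_iff₀ (by positivity)]
    linarith
  set P : ℕ → ℂ := fun k ↦ p + (k : ℂ) * v with hP
  have hP0 : P 0 = p := by simp [hP]
  have hPn : P n = p' := by
    simp only [hP, hv]
    have hn0 : ((n : ℝ) : ℂ) ≠ 0 := by exact_mod_cast hnpos.ne'
    field_simp
    push_cast
    field_simp
    ring
  have hPseg : ∀ k, k ≤ n → P k ∈ segment ℝ p p' := by
    intro k hk
    rw [segment_eq_image']
    refine ⟨(k : ℝ) / n, ⟨by positivity, ?_⟩, ?_⟩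
    · rw [div_le_one (by exact_mod_cast hnpos)]; exact_mod_cast hk
    · simp only [hP, hv]
      push_cast
      rw [div_eq_mul_inv]
      simp only [Complex.real_smul]
      push_cast
      ring
  have hstep : ∀ k, k < n → (Q (P k)).im / 3 ≤ (Q (P (k + 1))).im := by
    intro k hk
    have hball : ball (P k) δ ⊆ U := hseg _ (hPseg k hk.le)
    refine im_apply_ge_third hδ (hd.mono hball) (fun z hz ↦ hpos z (hball hz)) ?_
    have : P (k + 1) - P k = v := by simp only [hP]; push_cast; ring
    rw [this]
    exact hvn
  -- induction
  have hind : ∀ k, k ≤ n → (Q p).im / 3 ^ k ≤ (Q (P k)).im := by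
    intro k
    induction k with
    | zero => intro _; simp [hP0]
    | succ k ih =>
      intro hk
      have h1 := ih (Nat.le_of_succ_le hk)
      have h2 := hstep k (Nat.lt_of_succ_le hk)
      calc (Q p).im / 3 ^ (k + 1) = ((Q p).im / 3 ^ k) / 3 := by rw [pow_succ]; ring
        _ ≤ (Q (P k)).im / 3 := by gcongr
        _ ≤ (Q (P (k + 1))).im := h2
  simpa [hPn] using hind n le_rfl

end Harnack

/-! ### The half-disc comparison -/

section HalfDisc

/-- The frontier of the open upper half-disc `B(0, r) ∩ {im > 0}` consists of points of the
upper closed semicircle and of the real diameter. [folklore] -/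
theorem frontier_halfDisc_subset {r : ℝ} (hr : 0 < r) {z : ℂ}
    (hz : z ∈ frontier (ball (0 : ℂ) r ∩ {w : ℂ | 0 < w.im})) :
    (‖z‖ = r ∧ 0 ≤ z.im) ∨ (‖z‖ ≤ r ∧ z.im = 0) := by
  have h := frontier_inter_subset (ball (0 : ℂ) r) {w : ℂ | 0 < w.im} hz
  rw [frontier_ball (0 : ℂ) hr.ne', Complex.frontier_setOf_lt_im, Complex.closure_setOf_lt_im,
    closure_ball (0 : ℂ) hr.ne'] at h
  rcases h with ⟨h1, h2⟩ | ⟨h1, h2⟩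
  · exact Or.inl ⟨by simpa using h1, h2⟩
  · exact Or.inr ⟨by simpa using h1, h2⟩

/-- The explicit comparison polynomial `P(w) = w/r - w³/r³`: on the circle `|w| = r`,
`im P(w) = 2y(2y² - r²)/r³` with `y = im w`. [folklore] -/
theorem im_halfDiscPoly_of_norm_eq {r : ℝ} (hr : 0 < r) {w : ℂ} (hw : ‖w‖ = r) :
    (w / r - w ^ 3 / r ^ 3).im = 2 * w.im * (2 * w.im ^ 2 - r ^ 2) / r ^ 3 := by
  have hre : w.re ^ 2 = r ^ 2 - w.im ^ 2 := by
    have : ‖w‖ ^ 2 = r ^ 2 := by rw [hw]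
    rw [Complex.sq_norm, Complex.normSq_apply] at this
    nlinarith
  have h3 : (w ^ 3).im = 3 * w.re ^ 2 * w.im - w.im ^ 3 := by
    rw [pow_three]
    simp only [mul_im, mul_re]
    ring
  have hr0 : (r : ℂ) ≠ 0 := Complex.ofReal_ne_zero.2 hr.ne'
  rw [sub_im, Complex.div_ofReal_im, show ((r : ℂ) ^ 3) = ((r ^ 3 : ℝ) : ℂ) by push_cast; ring,
    Complex.div_ofReal_im, h3, hre]
  field_simp
  ring

/-- On the imaginary axis, `im P(iy) = y/r + y³/r³`. [folklore] -/
theorem im_halfDiscPoly_mul_I {r : ℝ} (y : ℝ) :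
    (((y : ℂ) * I) / r - ((y : ℂ) * I) ^ 3 / r ^ 3).im = y / r + y ^ 3 / r ^ 3 := by
  have h3 : (((y : ℂ) * I) ^ 3) = ((-(y ^ 3) : ℝ) : ℂ) * I := by
    push_cast
    ring_nf
    rw [Complex.I_pow_three]
    ring
  rw [h3, sub_im, Complex.div_ofReal_im, show ((r : ℂ) ^ 3) = ((r ^ 3 : ℝ) : ℂ) by push_cast; ring,
    Complex.div_ofReal_im, Complex.mul_I_im, Complex.mul_I_im, Complex.ofReal_re, Complex.ofReal_re]
  ring

/-- **Half-disc comparison lemma.** Let `Q` be holomorphic on a neighbourhood of the closed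
upper half-disc `{|w| ≤ r, im w ≥ 0}` with `im Q ≥ 0` there, and `im Q ≥ m` (`m ≥ 0`) on the
middle arc `{|w| = r, im w ≥ r/√2}`. Then `im Q(iy) ≥ (m/(2r)) y` for `0 < y < r`: the maximum
principle for `exp(i(Q - (m/2)P))`, `P(w) = w/r - w³/r³`, on the half-disc. [folklore] -/
theorem im_apply_mul_I_ge_of_halfDisc {Q : ℂ → ℂ} {r m : ℝ} (hr : 0 < r) (hm : 0 ≤ m)
    {U : Set ℂ} (hU : IsOpen U) (hsub : closedBall (0 : ℂ) r ∩ {w : ℂ | 0 ≤ w.im} ⊆ U)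
    (hd : DifferentiableOn ℂ Q U) (hpos : ∀ w ∈ closedBall (0 : ℂ) r, 0 ≤ w.im → 0 ≤ (Q w).im)
    (hmid : ∀ w : ℂ, ‖w‖ = r → r / Real.sqrt 2 ≤ w.im → m ≤ (Q w).im)
    {y : ℝ} (hy0 : 0 < y) (hyr : y < r) : m / (2 * r) * y ≤ (Q (y * I)).im := by
  set D : Set ℂ := ball (0 : ℂ) r ∩ {w : ℂ | 0 < w.im} with hD
  set P : ℂ → ℂ := fun w ↦ w / r - w ^ 3 / r ^ 3 with hP
  set F : ℂ → ℂ := fun w ↦ Complex.exp (Complex.I * (Q w - (m / 2 : ℝ) * P w)) with hF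
  have hclD : closure D ⊆ closedBall (0 : ℂ) r ∩ {w : ℂ | 0 ≤ w.im} := by
    refine (closure_inter_subset_inter_closure _ _).trans ?_
    rw [closure_ball (0 : ℂ) hr.ne', Complex.closure_setOf_lt_im]
  have hPd : Differentiable ℂ P := by
    intro w
    simp only [hP]
    fun_prop
  have hFd : DiffContOnCl ℂ F D := by
    refine DifferentiableOn.diffContOnCl fun w hw ↦ ?_
    have hwU : w ∈ U := hsub (hclD hw)
    have hQ : DifferentiableAt ℂ Q w := hd.differentiableAt (hU.mem_nhds hwU)
    exact (((hQ.sub ((differentiableAt_const _).mul (hPd w))).const_mul _).cexp).differentiableWithinAt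
  have hnormF : ∀ w, ‖F w‖ = Real.exp (-((Q w).im - m / 2 * (P w).im)) := by
    intro w
    rw [hF]
    dsimp only
    rw [Complex.norm_exp]
    congr 1
    simp only [mul_re, I_re, I_im, zero_mul, one_mul, zero_sub, sub_im, Complex.im_ofReal_mul]
  -- boundary values
  have hbd : ∀ z ∈ frontier D, ‖F z‖ ≤ 1 := by
    intro z hz
    rw [hnormF, Real.exp_le_one_iff, neg_nonpos, sub_nonneg]
    rcases frontier_halfDisc_subset hr hz with ⟨hzn, hzim⟩ | ⟨hzn, hzim⟩
    · -- on the semicircle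
      have hPz : (P z).im = 2 * z.im * (2 * z.im ^ 2 - r ^ 2) / r ^ 3 := im_halfDiscPoly_of_norm_eq hr hzn
      have hQz : 0 ≤ (Q z).im := hpos z (by rw [mem_closedBall, dist_zero_right, hzn]) hzim
      by_cases hside : z.im < r / Real.sqrt 2
      · -- side arcs: `im P ≤ 0`
        have h2 : 2 * z.im ^ 2 - r ^ 2 ≤ 0 := by
          have hs : z.im ^ 2 < (r / Real.sqrt 2) ^ 2 := pow_lt_pow_left₀ hside hzim two_ne_zero
          rw [div_pow, Real.sq_sqrt (by norm_num : (0:ℝ) ≤ 2)] at hs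
          linarith
        have hPle : (P z).im ≤ 0 := by
          rw [hPz]
          apply div_nonpos_of_nonpos_of_nonneg _ (by positivity)
          nlinarith
        nlinarith
      · -- middle arc: `im Q ≥ m` and `im P ≤ 2`
        rw [not_lt] at hside
        have hQm := hmid z hzn hside
        have hzim' : z.im ≤ r := by
          have := Complex.abs_im_le_norm z
          rw [hzn, abs_le] at this
          exact this.2
        have hPle : (P z).im ≤ 2 := by
          rw [hPz, div_le_iff₀ (by positivity)]
          have h1 : z.im ^ 2 ≤ r ^ 2 := pow_le_pow_left₀ hzim hzim' 2
          have h2 : 2 * z.im ^ 2 - r ^ 2 ≤ r ^ 2 := by linarith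
          have h3 : 2 * z.im * (2 * z.im ^ 2 - r ^ 2) ≤ 2 * r * r ^ 2 := by
            have h4 : 0 ≤ 2 * z.im ^ 2 - r ^ 2 := by
              have hs : (r / Real.sqrt 2) ^ 2 ≤ z.im ^ 2 := pow_le_pow_left₀ (by positivity) hside 2
              rw [div_pow, Real.sq_sqrt (by norm_num : (0:ℝ) ≤ 2)] at hs
              linarith
            calc 2 * z.im * (2 * z.im ^ 2 - r ^ 2) ≤ 2 * r * (2 * z.im ^ 2 - r ^ 2) := by
                  gcongr
              _ ≤ 2 * r * r ^ 2 := by gcongr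
          nlinarith
        nlinarith
    · -- on the diameter: `im P = 0`, `im Q ≥ 0`
      have hz : z = ((z.re : ℝ) : ℂ) := Complex.ext (by simp) (by simp [hzim])
      have hPz : (P z).im = 0 := by
        rw [hz, hP]
        dsimp only
        rw [sub_im, Complex.div_ofReal_im, show ((r : ℂ) ^ 3) = ((r ^ 3 : ℝ) : ℂ) by push_cast; ring,
          Complex.div_ofReal_im]
        norm_cast
        simp
      have hQz : 0 ≤ (Q z).im := hpos z (by rw [mem_closedBall, dist_zero_right]; exact hzn) hzim.ge
      rw [hPz, mul_zero]
      exact hQz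
  -- the interior point `iy`
  have hyD : (y : ℂ) * I ∈ closure D := subset_closure ⟨by
    rw [mem_ball, dist_zero_right, norm_mul, Complex.norm_real, Complex.norm_I, mul_one,
      Real.norm_eq_abs, abs_of_pos hy0]; exact hyr, by show 0 < ((y : ℂ) * I).im; simp [hy0]⟩
  have hbdd : Bornology.IsBounded D := (isBounded_ball).subset inter_subset_left
  have h := Complex.norm_le_of_forall_mem_frontier_norm_le hbdd hFd hbd hyD
  rw [hnormF, Real.exp_le_one_iff, neg_nonpos, sub_nonneg] at h
  have hPy : (P ((y : ℂ) * I)).im = y / r + y ^ 3 / r ^ 3 := im_halfDiscPoly_mul_I y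
  rw [hPy] at h
  have : m / (2 * r) * y ≤ m / 2 * (y / r + y ^ 3 / r ^ 3) := by
    have h1 : m / (2 * r) * y = m / 2 * (y / r) := by field_simp
    rw [h1]
    gcongr
    exact le_add_of_nonneg_right (by positivity)
  linarith

end HalfDisc

end Complex
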